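import Summits.ABC.IUTFork.Cor312Provenance
import Literature.IUT.LogVolume.Theorem110ToLegendre
import Summits.ABC.ABC.Theorems.IUTThetaPilotThetaPartIIOfThm110
import Summits.ABC.ABC.Theorems.IUTThetaPilotABCOfThetaPartII

/-!
# Kernel DAG index — layer C312, part zd: knitting DELTA 17 — the APEX AT THE REAL DATA in NEUTRAL form: [IUTchIII] Cor. 3.12 AS TYPED
at the verbatim setting OF real initial Θ-data is THE ONE NODE between the landed downstream chain and `ABC` (no skeleton family, no
number identification, no reading binder, no Team-A import)

index v1 · abc-iut-c312-2 (filer, gen 4) per HOME/plan/KERNEL-DAG-SPEC.md v1.3 §3 (edges with Lean content), §4 rules (2)–(3)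
("`A : AbcDictionary` is to be REPLACED by the landed [GenEll]/[IUTchIV] §2 reductions, whose named inputs then appear by name"; "`h312`
is replaced by the node(s) of the C312 layer BY NAME"). PROOF-ONLY (no definition), APPEND-ONLY, CO-IMPORT NEUTRAL: part w (Δ13,
`summit_real_of_xi_f`, p421601) did this through part p's (xi-f) node at the readings of record and therefore sits on side A of the
cell's co-import breaker F1; this part states the same apex ONE LEVEL UP — at the node [IUTchIII] Cor. 3.12 AS TYPED
(`Cor312.Setting.Statement`, abc-iut-c312-7) — importing only neutral modules (c312-8's `Cor312Provenance`, campaign S's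
`Theorem110ToLegendre` and `IUTThetaPilotThetaPartIIOfThm110`), so that branch C's `Conditional/AbcOfS.lean` (which imports no
breaker-side module) can compose over it: `AbcOfS` v1 = this apex ∘ `Conditional.layerC312_of_S` (p428164), see §3.

WHAT IS KNITTED (all BY NAME, all landed):
* abc-iut-c312-8's PROVENANCE (`Cor312Prov.IsSettingOf D Pv` — "`Pv` is the situation of Thm 3.11 / Cor 3.12 OF the initial Θ-datum
  `D`", [IUTchIII] Thm 3.11 opening l. 3–8 + [IUTchIV] Thm 1.10 p. 23 l. 27–30; `Cor312Prov.numericsOf D Pv J : Thm110Numerics` — the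
  numbers of [IUTchIV] Thm 1.10 FOR `(D, Pv)`; **`Cor312Prov.numericsOf_cor312_iff : (numericsOf D Pv J).Cor312 ↔ Pv.Statement`**) —
  so the skeleton apexes' number identifications `hΘ`/`hq` (DAGTop/DAGTopM/parts o–zc; `Conditional.abc_of_S` v0's two READ binders)
  are PROVENANCE, not hypotheses: `E_numerics_cor312_iff_statement` (S3's `Thm110Numerics.Cor312` is the same inequality
  `−absLogq ≤ negLogTheta` as skel II's `Thm110Data.Cor312` = the index node `N_IUTchIII_Cor3_12`, on S3's record type);
* campaign S's DOWNSTREAM CHAIN: abc-iut-S3's `Cor22.thm110Legendre_of_matchingNumerics` ([IUTchIV] Thm 1.10 in Legendre form from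
  per-point matching numerics with proof data and `Cor312`) and abc-iut-S4/plan's `Summit.ABC.ABC.Theorems.ABC_of_thm110Legendre_of_genEllTwo`
  (Cor 2.2 ⇒ Cor 2.3 ⇒ [GenEll] Thm 2.1 at `Σ = {2}` ⇒ `ABC`, modulo the route's ONE named debt `GenEllTwo`) — INLINED in the apex
  (part w's `E_ABC_of_matchingNumerics_of_GenEllTwo` is the same edge but lives on side A; the gate's dedup forbids re-stating it);
* **apex `summit_real_of_statement`** — `ABC` from: for every `η_prm`, every minimally presented `λ ∈ U_X`, every prime `l ≥ 5` with
  "admits an `F`-core", (P2), (P5), (P6): real initial Θ-data `D : InitialThetaData F K Fbar E l Pb` ([IUTchI] Def 3.1, abc-iut-L5-t2;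
  carrier types at universe 0, as S3's `Thm110Legendre` is), a full situation `S` of Theorem 3.11, a verbatim setting `Pv` that IS the
  setting of `D`, numerics inputs `J` matching `(λ, l, η_prm)` with `l ≠ 5`, Thm-1.10 proof data, and **[IUTchIII] Cor. 3.12 AS TYPED at
  `Pv`** (`Pv.Statement` — the C312 layer's root node, kernel id `IUTchIII:Cor3.12`); plus `GenEllTwo`. kernel_hyps = 2 (the
  data-existential `H` whose one claim-form conjunct is the Corollary as typed; `hG`). Compare DAGTop's `summit_of_cor312 V T A hInd h312`
  (kernel_hyps 2 + structure inputs V, T, A with propositional fields — abc-iut-w5-d035's "effective count"): here V/T/A are GONE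
  (replaced by the landed S chain + `GenEllTwo` by name) and `hInd` is GONE (the multiradial-estimate CONSTANT is inside S3's proof data /
  matching numerics, i.e. [IUTchIV] Thm 1.10's computation, campaign S), at the price of the honest data-existential `H`.
* §4 (appended, Δ17′): `summit_real_of_statement'` / `_pointwise'` — `hG` DISCHARGED by campaign S's `genEllTwo_holds`
  (`ABC_of_thm110Legendre`): kernel_hyps = 1, the data-existential whose one claim-form conjunct is the Corollary as typed.
* §3 `summit_real_of_statement_pointwise` — the same with the existential opened into explicit per-(η, λ, l) choice functions, the shape
  `Conditional/AbcOfS.lean` quantifies in ("per point `P`"): for C-cert's v1, replace its `hst : (Pc P).Statement` by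
  `(Conditional.layerC312_of_S (F P) (Pc P) (ρ P) (qK P) (hS P) (hPin P) (hBridge P) (hThm311 P)).2.2.2` — then S 1 · PIN 2 · CONE 1 ·
  FACT/route-debt 1 (`GenEllTwo`) · READ 0, and no `AbcDictionary`/`HeightFamily`/`Thm110Family`.
THIS FILE PROVES NOTHING NEW about [IUTchIII] §3 AND ASSERTS NOTHING; nothing here says abc is proved or refuted; no side taken on Cor. 3.12
or on any author; `GenEllTwo` and the Corollary-as-typed are NAMED HYPOTHESES. typed ≠ discharged; indexed ≠ endorsed.
[claim: Mochizuki2012, status: disputed]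
-/

noncomputable section

namespace Summit.ABC.IUTFork.DAG

open Thm311 Cor312Prov Literature.IUT.LogThetaLattice Literature.IUT.HodgeTheaters
open Literature.IUT.LogVolume Literature.IUT.LogVolume.Cor22 Literature.NumberTheory.DiophantineGeometry.GenEll

/-! ## 1. Provenance: the number identifications are theorems at the real data -/

section Provenance

variable {F K Fbar : Type} [Field F] [NumberField F] [Field K] [NumberField K] [Algebra F K] [Field Fbar] [Algebra F Fbar]
  [Algebra K Fbar] {E : WeierstrassCurve F} [E.IsElliptic] {l : ℕ} {Pb : BadPlacePredicates K}
variable (D : InitialThetaData F K Fbar E l Pb) {T : ThetaIndex} {S : Situation T} (Pv : Cor312.Setting S)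

/-- **EDGE (provenance), by name**: for a verbatim setting `Pv` that IS the setting of the initial Θ-datum `D`, S3's hypothesis
`Thm110Numerics.Cor312` on the numbers OF `(D, Pv)` ⟺ [IUTchIII] Cor. 3.12 AS TYPED at `Pv` (abc-iut-c312-8 `numericsOf_cor312_iff`).
[claim: Mochizuki2012, status: disputed] -/
theorem E_numerics_cor312_iff_statement (hP : IsSettingOf D Pv) (J : NumericsInputs D) :
    (numericsOf D Pv J).Cor312 ↔ Pv.Statement :=
  numericsOf_cor312_iff Pv J hP

end Provenance

/-! ## 2. The downstream chain as one edge; the apex at the real data -/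

/-- **APEX AT THE REAL DATA, NEUTRAL FORM — the one node is [IUTchIII] Cor. 3.12 AS TYPED.** `ABC` from: for every `η_prm`, every
minimally presented `λ ∈ U_X`, every prime `l ≥ 5` with "admits an `F`-core", (P2), (P5), (P6) — real initial Θ-data `D` (carriers at
universe 0), a situation `S` of Theorem 3.11, a verbatim setting `Pv` that IS the setting of `D` (`IsSettingOf`), numerics inputs `J`
matching `(λ, l, η_prm)` with `l ≠ 5`, Thm-1.10 proof data, and **the Corollary as typed at `Pv`** (`Pv.Statement`) —; plus `GenEllTwo`.
kernel_hyps = 2 (H, hG); no skeleton family (V/T/A gone), no multiradial-estimate binder (inside S3's proof data), no number identification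
(provenance, §1), no reading binder. The (xi-f)-node form is part w's `summit_real_of_xi_f` (side A); the S-form is §3 ∘ C-cert.
[claim: Mochizuki2012, status: disputed] -/
theorem summit_real_of_statement
    (H : ∀ η : ℝ, IsEtaPrm η → ∀ Pt : NFPoint, Pt ∈ UP → ∀ l : ℕ, l.Prime → 5 ≤ l →
      AdmitsCore Pt → CondP2 Pt l → CondP5 Pt l → CondP6 Pt l →
        ∃ (F : Type) (_ : Field F) (_ : NumberField F) (K : Type) (_ : Field K) (_ : NumberField K) (_ : Algebra F K)
          (Fbar : Type) (_ : Field Fbar) (_ : Algebra F Fbar) (_ : Algebra K Fbar) (E : WeierstrassCurve F) (_ : E.IsElliptic)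
          (Pb : BadPlacePredicates K) (D : InitialThetaData F K Fbar E l Pb) (T : ThetaIndex) (S : Situation T)
          (Pv : Cor312.Setting S) (J : NumericsInputs D),
          IsSettingOf D Pv ∧ Matches (numericsOf D Pv J) Pt l η ∧ (numericsOf D Pv J).l ≠ 5 ∧ Nonempty (numericsOf D Pv J).ProofData ∧
            Pv.Statement)
    (hG : Summit.ABC.ABC.Theses.IUTThetaPilot.GenEllTwo) : _root_.ABC := by
  -- the downstream chain BY NAME (S3 ∘ S4/plan); part w states this edge as `E_ABC_of_matchingNumerics_of_GenEllTwo` (side A),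
  -- so it is inlined here rather than re-stated (gate dedup) or imported (co-import neutrality)
  refine Summit.ABC.ABC.Theorems.ABC_of_thm110Legendre_of_genEllTwo
    (thm110Legendre_of_matchingNumerics fun η hη Pt hPt l hl h5 hc h2 h5' h6 => ?_) hG
  obtain ⟨F, _, _, K, _, _, _, Fbar, _, _, _, E, _, Pb, D, T, S, Pv, J, hP, hM, hne, hPD, hst⟩ :=
    H η hη Pt hPt l hl h5 hc h2 h5' h6
  exact ⟨numericsOf D Pv J, hM, hne, hPD, (numericsOf_cor312_iff Pv J hP).2 hst⟩

/-! ## 3. The pointwise shape (the one `Conditional/AbcOfS.lean` quantifies in) -/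

/-- **APEX AT THE REAL DATA, POINTWISE SHAPE.** The admissible points are packaged as an index: for each `(η, λ, l)` with the side
conditions, CHOSEN real data (choice functions instead of an existential) and the Corollary as typed at the chosen setting. This is the
shape branch C's certificate quantifies in ("per point"); `AbcOfS` v1 replaces `hst` below by `Conditional.layerC312_of_S … |>.2.2.2`
(S + three pins + bridge + typed Thm 3.11 ⟹ Statement) and keeps `hG` as its one FACT/route-debt binder — no `HeightFamily`, no
`Thm110Family`, no `AbcDictionary`, no READ binder. [claim: Mochizuki2012, status: disputed] -/
theorem summit_real_of_statement_pointwise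
    -- real data chosen for every admissible (η, λ, l): carriers and structures
    (Fc Kc Fbc : ∀ (η : ℝ) (Pt : NFPoint) (l : ℕ), Type)
    (iF : ∀ η Pt l, Field (Fc η Pt l)) (iFn : ∀ η Pt l, NumberField (Fc η Pt l))
    (iK : ∀ η Pt l, Field (Kc η Pt l)) (iKn : ∀ η Pt l, NumberField (Kc η Pt l)) (iA : ∀ η Pt l, Algebra (Fc η Pt l) (Kc η Pt l))
    (iFb : ∀ η Pt l, Field (Fbc η Pt l)) (iA1 : ∀ η Pt l, Algebra (Fc η Pt l) (Fbc η Pt l))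
    (iA2 : ∀ η Pt l, Algebra (Kc η Pt l) (Fbc η Pt l))
    (Ec : ∀ η Pt l, WeierstrassCurve (Fc η Pt l)) (iE : ∀ η Pt l, (Ec η Pt l).IsElliptic)
    (Pbc : ∀ η Pt l, BadPlacePredicates (Kc η Pt l))
    (Dc : ∀ η Pt l, InitialThetaData (Fc η Pt l) (Kc η Pt l) (Fbc η Pt l) (Ec η Pt l) l (Pbc η Pt l))
    (Tc : ∀ (η : ℝ) (Pt : NFPoint) (l : ℕ), ThetaIndex) (Sc : ∀ η Pt l, Situation (Tc η Pt l))
    (Pvc : ∀ η Pt l, Cor312.Setting (Sc η Pt l)) (Jc : ∀ η Pt l, NumericsInputs (Dc η Pt l))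
    -- provenance + matching + proof data at every admissible point (real-data well-formedness)
    (hP : ∀ η Pt l, IsEtaPrm η → Pt ∈ UP → l.Prime → 5 ≤ l → AdmitsCore Pt → CondP2 Pt l → CondP5 Pt l → CondP6 Pt l →
      IsSettingOf (Dc η Pt l) (Pvc η Pt l) ∧ Matches (numericsOf (Dc η Pt l) (Pvc η Pt l) (Jc η Pt l)) Pt l η ∧
        (numericsOf (Dc η Pt l) (Pvc η Pt l) (Jc η Pt l)).l ≠ 5 ∧ Nonempty (numericsOf (Dc η Pt l) (Pvc η Pt l) (Jc η Pt l)).ProofData)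
    -- THE ONE NODE: [IUTchIII] Cor. 3.12 as typed at every chosen setting
    (hst : ∀ η Pt l, IsEtaPrm η → Pt ∈ UP → l.Prime → 5 ≤ l → AdmitsCore Pt → CondP2 Pt l → CondP5 Pt l → CondP6 Pt l →
      (Pvc η Pt l).Statement)
    -- the route's one named debt
    (hG : Summit.ABC.ABC.Theses.IUTThetaPilot.GenEllTwo) : _root_.ABC :=
  summit_real_of_statement (fun η hη Pt hPt l hl h5 hc h2 h5' h6 =>
    ⟨Fc η Pt l, iF η Pt l, iFn η Pt l, Kc η Pt l, iK η Pt l, iKn η Pt l, iA η Pt l, Fbc η Pt l, iFb η Pt l, iA1 η Pt l, iA2 η Pt l,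
      Ec η Pt l, iE η Pt l, Pbc η Pt l, Dc η Pt l, Tc η Pt l, Sc η Pt l, Pvc η Pt l, Jc η Pt l,
      (hP η Pt l hη hPt hl h5 hc h2 h5' h6).1, (hP η Pt l hη hPt hl h5 hc h2 h5' h6).2.1, (hP η Pt l hη hPt hl h5 hc h2 h5' h6).2.2.1,
      (hP η Pt l hη hPt hl h5 hc h2 h5' h6).2.2.2, hst η Pt l hη hPt hl h5 hc h2 h5' h6⟩) hG

/-! ## 4. Δ17′ (appended): the route debt `GenEllTwo` is PROVED in the tree — the apex at the real data has ONE hypothesis -/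

/-- **APEX AT THE REAL DATA, DEBT-FREE: kernel_hyps = 1.** Campaign S proved the route's named debt ([GenEll] Thm 2.1 at `Σ = {2}`:
abc-iut-S6/S2 lineage `genEllTwo_holds`, packaged as `Summit.ABC.ABC.Theorems.ABC_of_thm110Legendre : Thm110Legendre → ABC`,
IUTThetaPilotABCOfThetaPartII.lean), so §2's `hG` is discharged BY NAME: `ABC` from the ONE data-existential `H` — for every admissible
`(η_prm, λ, l)`, real initial Θ-data with a verbatim setting OF it, matching numerics, Thm-1.10 proof data, and **[IUTchIII] Cor. 3.12 AS
TYPED at that setting**. Everything downstream of the Corollary is kernel-proved (campaign S); everything in it but the Corollary is data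
well-formedness of landed REAL objects (L5-t2 `InitialThetaData`, c312-8 `IsSettingOf`/`numericsOf`, S3 `Matches`/`ProofData`). Nothing
here says such data exist or that the Corollary holds for them. [claim: Mochizuki2012, status: disputed] -/
theorem summit_real_of_statement'
    (H : ∀ η : ℝ, IsEtaPrm η → ∀ Pt : NFPoint, Pt ∈ UP → ∀ l : ℕ, l.Prime → 5 ≤ l →
      AdmitsCore Pt → CondP2 Pt l → CondP5 Pt l → CondP6 Pt l →
        ∃ (F : Type) (_ : Field F) (_ : NumberField F) (K : Type) (_ : Field K) (_ : NumberField K) (_ : Algebra F K)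
          (Fbar : Type) (_ : Field Fbar) (_ : Algebra F Fbar) (_ : Algebra K Fbar) (E : WeierstrassCurve F) (_ : E.IsElliptic)
          (Pb : BadPlacePredicates K) (D : InitialThetaData F K Fbar E l Pb) (T : ThetaIndex) (S : Situation T)
          (Pv : Cor312.Setting S) (J : NumericsInputs D),
          IsSettingOf D Pv ∧ Matches (numericsOf D Pv J) Pt l η ∧ (numericsOf D Pv J).l ≠ 5 ∧ Nonempty (numericsOf D Pv J).ProofData ∧
            Pv.Statement) : _root_.ABC :=
  summit_real_of_statement H Summit.ABC.ABC.Theorems.genEllTwo_holds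

/-- **POINTWISE SHAPE, DEBT-FREE** — §3's `summit_real_of_statement_pointwise` with `hG` discharged by `genEllTwo_holds`: per admissible
`(η, λ, l)` chosen real data + provenance/matching/proof data + THE ONE NODE [IUTchIII] Cor. 3.12 as typed. For branch C:
`abc_of_S` at the real data = this ∘ `Conditional.layerC312_of_S` (S 1 · PIN 2 · CONE 1 · FACT 0 · READ 0), cf. C-cert-1's
`abc_of_S_v2` (p428991, at `Cor22.ThetaVolumeDatumAt`). [claim: Mochizuki2012, status: disputed] -/
theorem summit_real_of_statement_pointwise'
    (Fc Kc Fbc : ∀ (η : ℝ) (Pt : NFPoint) (l : ℕ), Type)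
    (iF : ∀ η Pt l, Field (Fc η Pt l)) (iFn : ∀ η Pt l, NumberField (Fc η Pt l))
    (iK : ∀ η Pt l, Field (Kc η Pt l)) (iKn : ∀ η Pt l, NumberField (Kc η Pt l)) (iA : ∀ η Pt l, Algebra (Fc η Pt l) (Kc η Pt l))
    (iFb : ∀ η Pt l, Field (Fbc η Pt l)) (iA1 : ∀ η Pt l, Algebra (Fc η Pt l) (Fbc η Pt l))
    (iA2 : ∀ η Pt l, Algebra (Kc η Pt l) (Fbc η Pt l))
    (Ec : ∀ η Pt l, WeierstrassCurve (Fc η Pt l)) (iE : ∀ η Pt l, (Ec η Pt l).IsElliptic)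
    (Pbc : ∀ η Pt l, BadPlacePredicates (Kc η Pt l))
    (Dc : ∀ η Pt l, InitialThetaData (Fc η Pt l) (Kc η Pt l) (Fbc η Pt l) (Ec η Pt l) l (Pbc η Pt l))
    (Tc : ∀ (η : ℝ) (Pt : NFPoint) (l : ℕ), ThetaIndex) (Sc : ∀ η Pt l, Situation (Tc η Pt l))
    (Pvc : ∀ η Pt l, Cor312.Setting (Sc η Pt l)) (Jc : ∀ η Pt l, NumericsInputs (Dc η Pt l))
    (hP : ∀ η Pt l, IsEtaPrm η → Pt ∈ UP → l.Prime → 5 ≤ l → AdmitsCore Pt → CondP2 Pt l → CondP5 Pt l → CondP6 Pt l →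
      IsSettingOf (Dc η Pt l) (Pvc η Pt l) ∧ Matches (numericsOf (Dc η Pt l) (Pvc η Pt l) (Jc η Pt l)) Pt l η ∧
        (numericsOf (Dc η Pt l) (Pvc η Pt l) (Jc η Pt l)).l ≠ 5 ∧ Nonempty (numericsOf (Dc η Pt l) (Pvc η Pt l) (Jc η Pt l)).ProofData)
    (hst : ∀ η Pt l, IsEtaPrm η → Pt ∈ UP → l.Prime → 5 ≤ l → AdmitsCore Pt → CondP2 Pt l → CondP5 Pt l → CondP6 Pt l →
      (Pvc η Pt l).Statement) : _root_.ABC :=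
  summit_real_of_statement_pointwise Fc Kc Fbc iF iFn iK iKn iA iFb iA1 iA2 Ec iE Pbc Dc Tc Sc Pvc Jc hP hst
    Summit.ABC.ABC.Theorems.genEllTwo_holds

end Summit.ABC.IUTFork.DAG

end
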